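import Literature.Barriers.Parity.SiegelZeroGoldbachPrimeSide
import Literature.NumberTheory.Sieve.SingularSeriesMultiplesMean
import HarnessLib

/-!
# Goldston–Suriajaya, Theorem 1: the Goldbach side `∑_k ψ₂(qk) ρ^{qk}` (§3), proved

Sibling of `Literature/Barriers/Parity/SiegelZeroPrimePairs.lean` (Goldston–Suriajaya,
arXiv:2104.09407, Theorem 1 = the named fact `Literature.Barriers.Parity.GoldstonSuriajaya2021_goldbach`).
Everything in this file is PROVED. It is §3 of the source ("Evaluating `𝒮(q)` using the
Goldbach Conjecture"). The printed (Sq1b) is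
`δV_q(N) + O(N log²N) ≤ 𝒮(q) ≤ (2 − δ)V_q(N) + O(N log²N)`, `V_q = q ∑_k 𝔖(qk) k e^{−qk/N}`,
where the remainder collects the odd multiples `qk` (`ψ₂(n) ≪ log²n` for odd `n`, (psi_2odd))
and the finitely many `qk` below the threshold of the conjecture. Here we prove the two halves
WITHOUT remainder under hypotheses that make it vanish: the lower half under (A)
`δ𝔖(qk)qk ≤ ψ₂(qk)` for all `k ≥ 1` (for odd `qk` this reads `0 ≤ ψ₂`, so the Weak
Hardy–Littlewood–Goldbach Conjecture supplies it as soon as `q` exceeds its threshold), and the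
upper half for EVEN `q` under (B) `ψ₂(qk) ≤ (2 − δ)𝔖(qk)qk` for the (even) multiples `qk`,
`k ≥ 1` — the assembly (`SiegelZeroGoldbachTheorem1.lean`) works modulo `2q`, which is how it
disposes of (psi_2odd). With `x = ρ^q` and `singW q x = ∑_k k𝔖(qk)x^k` (so `V_q = q · singW` at
`x = e^{−q/N}`) this gives `δ q W ≤ 𝒮` and `𝒮 ≤ (2 − δ) q W`; the two-sided evaluation of `V_q`
(GS21 (V_q=): `V_q(N) = N²/φ(q) + O(N log N log log N)`) is obtained in the form

* `singW_le` — `singW q x ≤ (q/φ(q)) ((1 + η)/(1 − x)² + (3/2 + K₀)/(1 − x))`,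
* `singW_ge` — `singW q x ≥ (q/φ(q)) ((1 − 2η) x²/(1 − x)² − K₀²/2)`,

for every `η ∈ (0, 1]` and every `K₀` beyond which the LOWER half of GS21 Lemma 1 holds in the
tree's uniform qualitative form `G_q(K) = ∑_{k ≤ K} 𝔖(qk) ≥ (1 − η)(q/φ(q))(K − 1)`
(`Literature.NumberTheory.Sieve.SingularSeriesMean.sum_goldbachSingularSeries_mul_ge`; the upper half
`G_q(K) ≤ (q/φ(q))K` is `…sum_goldbachSingularSeries_mul_le`). The route is partial summation
twice: `A_q(K) = ∑_{k ≤ K} k𝔖(qk) = K G_q(K) − ∑_{k<K} G_q(k)` (so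
`(q/φ(q))((½ − η)K(K−1) − K₀²/2) ≤ A_q(K) ≤ (q/φ(q))((1+η)K²/2 + (3/2 + K₀)K)`), then
`singW = (1 − x)∑_K A_q(K)x^K` and the closed forms of `∑ K^j x^K`, `j ≤ 2`.

## References

* D. A. Goldston, A. I. Suriajaya, *Note on the Goldbach conjecture and Landau–Siegel zeros*,
  arXiv:2104.09407 (2021), §3: (Sq1b), (V_q), (G_q), Lemma 1 (lem1), (V_q=), (Sq1c).
  [cite: GoldstonSuriajaya2021, §3]
-/

noncomputable section

open Finset Real
open scoped ArithmeticFunction.vonMangoldt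

namespace Literature.Barriers.Parity

namespace GoldstonSuriajaya

open Literature.NumberTheory.Sieve

/-! ### The second moment `∑ K(K − 1) x^K` -/

/-- `2 · C(n + 2, 2) = (n + 2)(n + 1)`. [folklore] -/
theorem two_mul_choose_two_cast (n : ℕ) : (2 : ℝ) * ((n + 2).choose 2 : ℕ) = ((n : ℝ) + 2) * ((n : ℝ) + 1) := by
  induction n with
  | zero => norm_num
  | succ n ih =>
    rw [show n + 1 + 2 = (n + 2) + 1 by ring, Nat.choose_succ_succ' (n + 2) 1, Nat.choose_one_right,
      Nat.cast_add, mul_add, ih]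
    push_cast
    ring

variable {x : ℝ}

/-- `∑_K K(K − 1) x^K = 2x²/(1 − x)³` for `0 ≤ x < 1`. [folklore] -/
theorem tsum_mul_sub_one_mul_pow_eq (hx0 : 0 ≤ x) (hx1 : x < 1) :
    ∑' K : ℕ, (K : ℝ) * ((K : ℝ) - 1) * x ^ K = 2 * x ^ 2 / (1 - x) ^ 3 := by
  have hnorm : ‖x‖ < 1 := by rwa [Real.norm_of_nonneg hx0]
  have h2 := hasSum_choose_mul_geometric_of_norm_lt_one 2 hnorm
  -- shift by two
  have hs : Summable (fun K : ℕ => (K : ℝ) * ((K : ℝ) - 1) * x ^ K) := by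
    have h := (summable_pow_mul_pow hx0 hx1 2).add (summable_pow_mul_pow hx0 hx1 1)
    refine (h.of_nonneg_of_le (fun K => ?_) (fun K => ?_)).of_norm
    · exact norm_nonneg _
    · rw [Real.norm_eq_abs]
      rcases Nat.eq_zero_or_pos K with rfl | hK
      · simp
      · have hK1 : (1 : ℝ) ≤ K := by exact_mod_cast hK
        have hxK := pow_nonneg hx0 K
        have hnn : 0 ≤ (K : ℝ) * ((K : ℝ) - 1) * x ^ K :=
          mul_nonneg (mul_nonneg (by linarith) (by linarith)) hxK
        rw [abs_of_nonneg hnn]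
        nlinarith
  rw [hs.tsum_eq_zero_add, ((summable_nat_add_iff 1).mpr hs).tsum_eq_zero_add]
  have heq : ∀ K : ℕ, ((K + 1 + 1 : ℕ) : ℝ) * (((K + 1 + 1 : ℕ) : ℝ) - 1) * x ^ (K + 1 + 1) =
      x ^ 2 * ((2 : ℝ) * ((K + 2).choose 2 : ℕ) * x ^ K) := by
    intro K
    rw [two_mul_choose_two_cast, pow_add]
    push_cast
    ring
  rw [tsum_congr heq, tsum_mul_left]
  simp_rw [mul_assoc]
  rw [tsum_mul_left, h2.tsum_eq]
  simp
  ring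

/-- `∑_K K² x^K = x(1 + x)/(1 − x)³` for `0 ≤ x < 1`. [folklore] -/
theorem tsum_sq_mul_pow_eq (hx0 : 0 ≤ x) (hx1 : x < 1) :
    ∑' K : ℕ, (K : ℝ) ^ 2 * x ^ K = x * (1 + x) / (1 - x) ^ 3 := by
  have h2 := summable_pow_mul_pow hx0 hx1 2
  have h1 : Summable (fun i : ℕ => (i : ℝ) * x ^ i) := by simpa using summable_pow_mul_pow hx0 hx1 1
  have heq : ∀ K : ℕ, (K : ℝ) ^ 2 * x ^ K = (K : ℝ) * ((K : ℝ) - 1) * x ^ K + (K : ℝ) * x ^ K :=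
    fun K => by ring
  have hs : Summable (fun K : ℕ => (K : ℝ) * ((K : ℝ) - 1) * x ^ K) := by
    refine (h2.sub h1).congr fun K => ?_
    ring
  rw [tsum_congr heq, hs.tsum_add h1, tsum_mul_sub_one_mul_pow_eq hx0 hx1, tsum_nat_mul_pow_eq hx0 hx1]
  have : (1 - x) ≠ 0 := by linarith
  field_simp
  ring

/-! ### `G_q`, `A_q` and partial summation -/

/-- `G_q(K) = ∑_{1 ≤ k ≤ K} 𝔖(qk)` (GS21 (G_q)). [cite: GoldstonSuriajaya2021, §3 (G_q)] -/
def singG (q K : ℕ) : ℝ := ∑ k ∈ Ioc 0 K, goldbachSingularSeries (q * k)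

/-- `A_q(K) = ∑_{1 ≤ k ≤ K} k 𝔖(qk)`, the partial sums of the coefficients of
`V_q = q∑_k 𝔖(qk) k e^{−qk/N}` (GS21 (V_q)). [cite: GoldstonSuriajaya2021, §3 (V_q)] -/
def singA (q K : ℕ) : ℝ := ∑ k ∈ Ioc 0 K, (k : ℝ) * goldbachSingularSeries (q * k)

/-- `W = ∑_k k 𝔖(qk) x^k`, so that `V_q(N) = q · W` at `x = e^{−q/N}` (GS21 (V_q)).
[cite: GoldstonSuriajaya2021, §3 (V_q)] -/
def singW (q : ℕ) (x : ℝ) : ℝ := ∑' k : ℕ, (k : ℝ) * goldbachSingularSeries (q * k) * x ^ k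

/-- `G_q(0) = 0`. [folklore] -/
theorem singG_zero (q : ℕ) : singG q 0 = 0 := by simp [singG]

/-- `G_q(K + 1) = G_q(K) + 𝔖(q(K + 1))`. [folklore] -/
theorem singG_succ (q K : ℕ) : singG q (K + 1) = singG q K + goldbachSingularSeries (q * (K + 1)) := by
  rw [singG, singG, sum_Ioc_succ_top (Nat.zero_le K)]

/-- `A_q(K + 1) = A_q(K) + (K + 1)𝔖(q(K + 1))`. [folklore] -/
theorem singA_succ (q K : ℕ) :
    singA q (K + 1) = singA q K + ((K : ℝ) + 1) * goldbachSingularSeries (q * (K + 1)) := by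
  rw [singA, singA, sum_Ioc_succ_top (Nat.zero_le K)]
  push_cast
  ring

/-- `G_q ≥ 0`. [folklore] -/
theorem singG_nonneg (q K : ℕ) : 0 ≤ singG q K :=
  sum_nonneg fun _ _ => SingularSeriesMean.goldbachSingularSeries_nonneg _

/-- `A_q ≥ 0`. [folklore] -/
theorem singA_nonneg (q K : ℕ) : 0 ≤ singA q K :=
  sum_nonneg fun k _ => mul_nonneg (Nat.cast_nonneg k) (SingularSeriesMean.goldbachSingularSeries_nonneg _)

/-- `A_q(K) ≤ K G_q(K)`. [folklore] -/
theorem singA_le_mul_singG (q K : ℕ) : singA q K ≤ K * singG q K := by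
  rw [singA, singG, mul_sum]
  refine sum_le_sum fun k hk => ?_
  rw [mem_Ioc] at hk
  exact mul_le_mul_of_nonneg_right (by exact_mod_cast hk.2)
    (SingularSeriesMean.goldbachSingularSeries_nonneg _)

/-- **Partial summation**: `A_q(K) = K G_q(K) − ∑_{k<K} G_q(k)`. [folklore] -/
theorem singA_eq (q K : ℕ) : singA q K = K * singG q K - ∑ k ∈ range K, singG q k := by
  induction K with
  | zero => simp [singA, singG]
  | succ K ih =>
    rw [singA_succ, ih, sum_range_succ, singG_succ]
    push_cast
    ring

/-- `∑_{k<K} (k − 1 − K₀) = K(K−1)/2 − K(1 + K₀)`. [folklore] -/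
theorem sum_range_sub_eq (K K₀ : ℕ) :
    ∑ k ∈ range K, ((k : ℝ) - 1 - K₀) = (K : ℝ) * ((K : ℝ) - 1) / 2 - K * (1 + K₀) := by
  rw [sum_sub_distrib, sum_sub_distrib, sum_const, card_range, sum_const, card_range, nsmul_eq_mul,
    nsmul_eq_mul]
  have h := congrArg (Nat.cast (R := ℝ)) (sum_range_id_mul_two K)
  push_cast at h
  rcases Nat.eq_zero_or_pos K with rfl | hK
  · simp
  · rw [Nat.cast_sub hK] at h
    push_cast at h
    linarith

/-- **Upper bound for `A_q`.** If `G_q(K) ≥ (1 − η)(q/φ(q))(K − 1)` for `K ≥ K₀` (`0 < η ≤ 1`)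
then `A_q(K) ≤ (q/φ(q))((1 + η)K²/2 + (3/2 + K₀)K)` (with `G_q(K) ≤ (q/φ(q))K`, GS21 Lemma 1,
upper half, from the tree). [cite: GoldstonSuriajaya2021, §3 (V_q=)] -/
theorem singA_le {q : ℕ} (hq : q ≠ 0) {η : ℝ} (hη0 : 0 < η) (hη1 : η ≤ 1) {K₀ : ℕ}
    (hlow : ∀ K : ℕ, K₀ ≤ K → (1 - η) * ((q : ℝ) / Nat.totient q) * ((K : ℝ) - 1) ≤ singG q K)
    (K : ℕ) :
    singA q K ≤ (q : ℝ) / Nat.totient q * ((1 + η) * (K : ℝ) ^ 2 / 2 + (3 / 2 + K₀) * K) := by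
  set c : ℝ := (q : ℝ) / Nat.totient q with hcdef
  have hc : 0 ≤ c := by positivity
  have hK0 : (0 : ℝ) ≤ K := Nat.cast_nonneg K
  -- uniform lower bound `G_q(k) ≥ (1 − η) c (k − 1 − K₀)`
  have hGlow : ∀ k : ℕ, (1 - η) * c * ((k : ℝ) - 1 - K₀) ≤ singG q k := by
    intro k
    by_cases hk : K₀ ≤ k
    · refine le_trans ?_ (hlow k hk)
      have : 0 ≤ (1 - η) * c * (K₀ : ℝ) := by
        have : (0 : ℝ) ≤ 1 - η := by linarith
        positivity
      nlinarith
    · rw [not_le] at hk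
      have hk' : (k : ℝ) - 1 - K₀ ≤ 0 := by
        have : (k : ℝ) < K₀ := by exact_mod_cast hk
        linarith
      have h1 : (1 - η) * c * ((k : ℝ) - 1 - K₀) ≤ 0 :=
        mul_nonpos_of_nonneg_of_nonpos (mul_nonneg (by linarith) hc) hk'
      exact h1.trans (singG_nonneg q k)
  have hsumG : (1 - η) * c * ((K : ℝ) * ((K : ℝ) - 1) / 2 - K * (1 + K₀)) ≤ ∑ k ∈ range K, singG q k := by
    rw [← sum_range_sub_eq K K₀, mul_sum]
    exact sum_le_sum fun k _ => hGlow k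
  have hGup : singG q K ≤ c * K := SingularSeriesMean.sum_goldbachSingularSeries_mul_le hq K
  rw [singA_eq]
  have h1 : (K : ℝ) * singG q K ≤ c * (K : ℝ) ^ 2 := by nlinarith
  have hη' : (0 : ℝ) ≤ 1 - η := by linarith
  nlinarith [mul_nonneg hc hK0, mul_nonneg (mul_nonneg hc hK0) hη0.le,
    mul_nonneg (mul_nonneg hc hK0) (Nat.cast_nonneg K₀), mul_nonneg (mul_nonneg hc hK0) hη']

/-- **Lower bound for `A_q`.** Under the same hypothesis,
`A_q(K) ≥ (q/φ(q))((½ − η)K(K − 1) − K₀²/2)`. [cite: GoldstonSuriajaya2021, §3 (V_q=)] -/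
theorem singA_ge {q : ℕ} (hq : q ≠ 0) {η : ℝ} (hη0 : 0 < η) {K₀ : ℕ}
    (hlow : ∀ K : ℕ, K₀ ≤ K → (1 - η) * ((q : ℝ) / Nat.totient q) * ((K : ℝ) - 1) ≤ singG q K)
    (K : ℕ) :
    (q : ℝ) / Nat.totient q * ((1 / 2 - η) * ((K : ℝ) * ((K : ℝ) - 1)) - (K₀ : ℝ) ^ 2 / 2) ≤ singA q K := by
  set c : ℝ := (q : ℝ) / Nat.totient q with hcdef
  have hc : 0 ≤ c := by positivity
  have hK0 : (0 : ℝ) ≤ K := Nat.cast_nonneg K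
  by_cases hK : K₀ ≤ K
  · -- `A(K) ≥ K G(K) − ∑_{k<K} c k ≥ (1−η)cK(K−1) − cK(K−1)/2`
    have hsumG : ∑ k ∈ range K, singG q k ≤ c * ((K : ℝ) * ((K : ℝ) - 1) / 2) := by
      calc ∑ k ∈ range K, singG q k ≤ ∑ k ∈ range K, c * (k : ℝ) :=
            sum_le_sum fun k _ => SingularSeriesMean.sum_goldbachSingularSeries_mul_le hq k
        _ = c * ((K : ℝ) * ((K : ℝ) - 1) / 2) := by
            rw [← mul_sum]
            congr 1
            have h := congrArg (Nat.cast (R := ℝ)) (sum_range_id_mul_two K)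
            push_cast at h
            rcases Nat.eq_zero_or_pos K with rfl | hK1
            · simp
            · rw [Nat.cast_sub hK1] at h
              push_cast at h
              linarith
    have hGK := hlow K hK
    rw [singA_eq]
    have hK1 : (K : ℝ) * ((1 - η) * c * ((K : ℝ) - 1)) ≤ K * singG q K :=
      mul_le_mul_of_nonneg_left hGK hK0
    have hK₀0 : (0 : ℝ) ≤ (K₀ : ℝ) ^ 2 / 2 := by positivity
    nlinarith [mul_nonneg hc hK₀0]
  · rw [not_le] at hK
    refine le_trans ?_ (singA_nonneg q K)
    apply mul_nonpos_of_nonneg_of_nonpos hc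
    have h1 : (K : ℝ) * ((K : ℝ) - 1) ≤ (K₀ : ℝ) ^ 2 := by
      have hKK : (K : ℝ) ≤ K₀ := by exact_mod_cast hK.le
      nlinarith
    have h2 : (1 / 2 - η) * ((K : ℝ) * ((K : ℝ) - 1)) ≤ 1 / 2 * ((K : ℝ) * ((K : ℝ) - 1)) := by
      have : 0 ≤ (K : ℝ) * ((K : ℝ) - 1) := by
        rcases Nat.eq_zero_or_pos K with rfl | hK1
        · simp
        · have : (1 : ℝ) ≤ K := by exact_mod_cast hK1
          nlinarith
      nlinarith
    linarith

/-! ### The weighted sums -/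

/-- `∑_K A_q(K) x^K` converges (`A_q(K) ≤ K G_q(K) ≤ (q/φ(q))K²`). [folklore] -/
theorem summable_singA_mul_pow {q : ℕ} (hq : q ≠ 0) (hx0 : 0 ≤ x) (hx1 : x < 1) :
    Summable (fun K : ℕ => singA q K * x ^ K) := by
  refine summable_mul_pow_of_le hx0 hx1 2 (C := (q : ℝ) / Nat.totient q) (singA_nonneg q) fun K => ?_
  calc singA q K ≤ K * singG q K := singA_le_mul_singG q K
    _ ≤ K * ((q : ℝ) / Nat.totient q * K) :=
        mul_le_mul_of_nonneg_left (SingularSeriesMean.sum_goldbachSingularSeries_mul_le hq K)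
          (Nat.cast_nonneg K)
    _ = (q : ℝ) / Nat.totient q * (K : ℝ) ^ 2 := by ring

/-- `A_q(K)` are the partial sums of `k ↦ k𝔖(qk)` over `range (K + 1)`. [folklore] -/
theorem sum_range_succ_eq_singA (q K : ℕ) :
    ∑ k ∈ range (K + 1), (k : ℝ) * goldbachSingularSeries (q * k) = singA q K := by
  have h : range (K + 1) = insert 0 (Ioc 0 K) := by
    ext d
    simp only [mem_range, mem_insert, mem_Ioc]
    omega
  rw [h, sum_insert (by simp), singA]
  simp

/-- **Partial summation**: `W = (1 − x)∑_K A_q(K)x^K`. [cite: GoldstonSuriajaya2021, §3 (V_q=)] -/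
theorem singW_eq {q : ℕ} (hq : q ≠ 0) (hx0 : 0 ≤ x) (hx1 : x < 1) :
    singW q x = (1 - x) * ∑' K : ℕ, singA q K * x ^ K := by
  have hA := summable_singA_mul_pow hq hx0 hx1
  simp_rw [← sum_range_succ_eq_singA] at hA ⊢
  exact tsum_mul_pow_eq hA

/-- `W` is summable termwise: `k𝔖(qk)x^k ≤ (q/φ(q)) k² x^k`. [folklore] -/
theorem summable_singW_terms {q : ℕ} (hq : q ≠ 0) (hx0 : 0 ≤ x) (hx1 : x < 1) :
    Summable (fun k : ℕ => (k : ℝ) * goldbachSingularSeries (q * k) * x ^ k) := by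
  have hA := summable_singA_mul_pow hq hx0 hx1
  simp_rw [← sum_range_succ_eq_singA] at hA
  exact summable_mul_pow_of_summable_sum hA

/-- **GS21 (V_q=), upper bound**: for `0 ≤ x < 1`, `0 < η ≤ 1` and `K₀` as in the lower half of
Lemma 1, `W ≤ (q/φ(q))((1 + η)/(1 − x)² + (3/2 + K₀)/(1 − x))` (the source:
`V_q(N) = N²/φ(q) + O(N log N log log N)`, `V_q = qW`, `1 − x ≈ q/N`).
[cite: GoldstonSuriajaya2021, §3 (V_q=)] -/
theorem singW_le {q : ℕ} (hq : q ≠ 0) (hx0 : 0 ≤ x) (hx1 : x < 1) {η : ℝ} (hη0 : 0 < η) (hη1 : η ≤ 1)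
    {K₀ : ℕ}
    (hlow : ∀ K : ℕ, K₀ ≤ K → (1 - η) * ((q : ℝ) / Nat.totient q) * ((K : ℝ) - 1) ≤ singG q K) :
    singW q x ≤ (q : ℝ) / Nat.totient q * ((1 + η) / (1 - x) ^ 2 + (3 / 2 + K₀) / (1 - x)) := by
  set c : ℝ := (q : ℝ) / Nat.totient q with hcdef
  have hc : 0 ≤ c := by positivity
  have h1x : 0 < 1 - x := by linarith
  rw [singW_eq hq hx0 hx1]
  have hA := summable_singA_mul_pow hq hx0 hx1
  have h2 := summable_pow_mul_pow hx0 hx1 2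
  have h1 : Summable (fun i : ℕ => (i : ℝ) * x ^ i) := by simpa using summable_pow_mul_pow hx0 hx1 1
  set B : ℕ → ℝ := fun K => c * ((1 + η) * (K : ℝ) ^ 2 / 2 + (3 / 2 + K₀) * K) with hBdef
  have hBeq : ∀ K : ℕ, B K * x ^ K =
      (c * (1 + η) / 2) * ((K : ℝ) ^ 2 * x ^ K) + (c * (3 / 2 + K₀)) * ((K : ℝ) * x ^ K) := by
    intro K
    simp only [hBdef]
    ring
  have hsB : Summable (fun K : ℕ => B K * x ^ K) :=
    ((h2.mul_left _).add (h1.mul_left _)).congr fun K => (hBeq K).symm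
  have hle : ∑' K : ℕ, singA q K * x ^ K ≤ ∑' K : ℕ, B K * x ^ K :=
    hA.tsum_le_tsum (fun K => mul_le_mul_of_nonneg_right (singA_le hq hη0 hη1 hlow K) (pow_nonneg hx0 K))
      hsB
  have heval : ∑' K : ℕ, B K * x ^ K =
      (c * (1 + η) / 2) * (x * (1 + x) / (1 - x) ^ 3) + (c * (3 / 2 + K₀)) * (x / (1 - x) ^ 2) := by
    rw [tsum_congr hBeq, (h2.mul_left _).tsum_add (h1.mul_left _), tsum_mul_left, tsum_mul_left,
      tsum_sq_mul_pow_eq hx0 hx1, tsum_nat_mul_pow_eq hx0 hx1]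
  rw [heval] at hle
  calc (1 - x) * ∑' K : ℕ, singA q K * x ^ K
      ≤ (1 - x) * ((c * (1 + η) / 2) * (x * (1 + x) / (1 - x) ^ 3) +
          (c * (3 / 2 + K₀)) * (x / (1 - x) ^ 2)) := mul_le_mul_of_nonneg_left hle h1x.le
    _ = c * ((1 + η) * (x * (1 + x) / 2) / (1 - x) ^ 2 + (3 / 2 + K₀) * x / (1 - x)) := by
        field_simp
    _ ≤ c * ((1 + η) / (1 - x) ^ 2 + (3 / 2 + K₀) / (1 - x)) := by
        refine mul_le_mul_of_nonneg_left (add_le_add ?_ ?_) hc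
        · refine div_le_div_of_nonneg_right ?_ (by positivity)
          have : x * (1 + x) / 2 ≤ 1 := by nlinarith
          nlinarith
        · refine div_le_div_of_nonneg_right ?_ h1x.le
          have : (0 : ℝ) ≤ 3 / 2 + K₀ := by positivity
          nlinarith

/-- **GS21 (V_q=), lower bound**: for `0 ≤ x < 1`, `0 < η` and `K₀` as in the lower half of
Lemma 1, `W ≥ (q/φ(q))((1 − 2η)x²/(1 − x)² − K₀²/2)`. [cite: GoldstonSuriajaya2021, §3 (V_q=)] -/
theorem singW_ge {q : ℕ} (hq : q ≠ 0) (hx0 : 0 ≤ x) (hx1 : x < 1) {η : ℝ} (hη0 : 0 < η) {K₀ : ℕ}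
    (hlow : ∀ K : ℕ, K₀ ≤ K → (1 - η) * ((q : ℝ) / Nat.totient q) * ((K : ℝ) - 1) ≤ singG q K) :
    (q : ℝ) / Nat.totient q * ((1 - 2 * η) * x ^ 2 / (1 - x) ^ 2 - (K₀ : ℝ) ^ 2 / 2) ≤ singW q x := by
  set c : ℝ := (q : ℝ) / Nat.totient q with hcdef
  have hc : 0 ≤ c := by positivity
  have h1x : 0 < 1 - x := by linarith
  rw [singW_eq hq hx0 hx1]
  have hA := summable_singA_mul_pow hq hx0 hx1
  have h0 : Summable (fun i : ℕ => x ^ i) := summable_geometric_of_lt_one hx0 hx1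
  have hKK : Summable (fun K : ℕ => (K : ℝ) * ((K : ℝ) - 1) * x ^ K) := by
    have h1 : Summable (fun i : ℕ => (i : ℝ) * x ^ i) := by simpa using summable_pow_mul_pow hx0 hx1 1
    refine ((summable_pow_mul_pow hx0 hx1 2).sub h1).congr fun K => ?_
    ring
  set B : ℕ → ℝ := fun K => c * ((1 / 2 - η) * ((K : ℝ) * ((K : ℝ) - 1)) - (K₀ : ℝ) ^ 2 / 2) with hBdef
  have hBeq : ∀ K : ℕ, B K * x ^ K =
      (c * (1 / 2 - η)) * ((K : ℝ) * ((K : ℝ) - 1) * x ^ K) - (c * (K₀ : ℝ) ^ 2 / 2) * x ^ K := by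
    intro K
    simp only [hBdef]
    ring
  have hsB : Summable (fun K : ℕ => B K * x ^ K) :=
    ((hKK.mul_left _).sub (h0.mul_left _)).congr fun K => (hBeq K).symm
  have hle : ∑' K : ℕ, B K * x ^ K ≤ ∑' K : ℕ, singA q K * x ^ K :=
    hsB.tsum_le_tsum (fun K => mul_le_mul_of_nonneg_right (singA_ge hq hη0 hlow K) (pow_nonneg hx0 K))
      hA
  have heval : ∑' K : ℕ, B K * x ^ K =
      (c * (1 / 2 - η)) * (2 * x ^ 2 / (1 - x) ^ 3) - (c * (K₀ : ℝ) ^ 2 / 2) * (1 / (1 - x)) := by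
    rw [tsum_congr hBeq, (hKK.mul_left _).tsum_sub (h0.mul_left _), tsum_mul_left, tsum_mul_left,
      tsum_mul_sub_one_mul_pow_eq hx0 hx1, tsum_pow_eq hx0 hx1]
  rw [heval] at hle
  calc c * ((1 - 2 * η) * x ^ 2 / (1 - x) ^ 2 - (K₀ : ℝ) ^ 2 / 2)
      = (1 - x) * ((c * (1 / 2 - η)) * (2 * x ^ 2 / (1 - x) ^ 3) -
          (c * (K₀ : ℝ) ^ 2 / 2) * (1 / (1 - x))) := by
        field_simp
    _ ≤ (1 - x) * ∑' K : ℕ, singA q K * x ^ K := mul_le_mul_of_nonneg_left hle h1x.le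

/-! ### `𝒮` against `W` under (A) and (B) -/

/-- **GS21 (Sq1b), upper half, for an even modulus (no remainder).** Let `q` be EVEN. If
`ψ₂(qk) ≤ (2 − δ)𝔖(qk)·qk` for every `k ≥ 1` (bound (B) of the Weak Hardy–Littlewood–Goldbach
Conjecture on the multiples `qk`, all even; available once `q` exceeds the conjecture's
threshold), then `𝒮 ≤ (2 − δ) q W` at `x = ρ^q`. For odd `q` the hypothesis would fail at the odd
multiples (`𝔖(qk) = 0 < ψ₂(qk)` is possible), which is where the printed (Sq1b),
`𝒮(q) ≤ (2 − δ)V_q(N) + O(N log²N)`, carries its remainder; the assembly avoids this by passing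
to the modulus `2q`. [cite: GoldstonSuriajaya2021, §3 (Sq1b)] -/
theorem genPairSum_le_of_B {q : ℕ} [NeZero q] (hq2 : Even q) {ρ δ : ℝ} (hρ0 : 0 ≤ ρ) (hρ1 : ρ < 1)
    (hB : ∀ k : ℕ, 1 ≤ k → Even (q * k) → goldbachLambdaCount (q * k) ≤
      (2 - δ) * (goldbachSingularSeries (q * k) * ((q * k : ℕ) : ℝ))) :
    genPairSum q ρ ≤ (2 - δ) * q * singW q (ρ ^ q) := by
  have hq : q ≠ 0 := NeZero.ne q
  have hx0 : 0 ≤ ρ ^ q := pow_nonneg hρ0 q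
  have hx1 : ρ ^ q < 1 := pow_lt_one₀ hρ0 hρ1 hq
  rw [genPairSum_eq_tsum q hρ0 hρ1, singW, ← tsum_mul_left]
  refine (summable_goldbachLambdaCount_mul_pow q hx0 hx1).tsum_le_tsum (fun k => ?_)
    ((summable_singW_terms hq hx0 hx1).mul_left _)
  rcases Nat.eq_zero_or_pos k with rfl | hk
  · simp [goldbachLambdaCount]
  · have h := hB k hk (hq2.mul_right k)
    push_cast at h
    have hx := pow_nonneg hx0 k
    calc goldbachLambdaCount (q * k) * (ρ ^ q) ^ k
        ≤ (2 - δ) * (goldbachSingularSeries (q * k) * ((q : ℝ) * k)) * (ρ ^ q) ^ k :=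
          mul_le_mul_of_nonneg_right h hx
      _ = (2 - δ) * q * ((k : ℝ) * goldbachSingularSeries (q * k) * (ρ ^ q) ^ k) := by ring

/-- **GS21 (Sq1b), lower half (no remainder).** If `δ𝔖(qk)·qk ≤ ψ₂(qk)` for all `k ≥ 1`
(bound (A) of the Weak Hardy–Littlewood–Goldbach Conjecture on the even multiples of `q`, and the
triviality `0 ≤ ψ₂(qk)` on the odd ones, where `𝔖(qk) = 0`; so the conjecture supplies it once `q`
exceeds its threshold), then `δ q W ≤ 𝒮` at `x = ρ^q` (the printed (Sq1b):
`δV_q(N) + O(N log²N) ≤ 𝒮(q)`). [cite: GoldstonSuriajaya2021, §3 (Sq1b)] -/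
theorem genPairSum_ge_of_A {q : ℕ} [NeZero q] {ρ δ : ℝ} (hρ0 : 0 ≤ ρ) (hρ1 : ρ < 1)
    (hA : ∀ k : ℕ, 1 ≤ k → δ * (goldbachSingularSeries (q * k) * ((q * k : ℕ) : ℝ)) ≤
      goldbachLambdaCount (q * k)) :
    δ * q * singW q (ρ ^ q) ≤ genPairSum q ρ := by
  have hq : q ≠ 0 := NeZero.ne q
  have hx0 : 0 ≤ ρ ^ q := pow_nonneg hρ0 q
  have hx1 : ρ ^ q < 1 := pow_lt_one₀ hρ0 hρ1 hq
  rw [genPairSum_eq_tsum q hρ0 hρ1, singW, ← tsum_mul_left]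
  refine ((summable_singW_terms hq hx0 hx1).mul_left _).tsum_le_tsum (fun k => ?_)
    (summable_goldbachLambdaCount_mul_pow q hx0 hx1)
  rcases Nat.eq_zero_or_pos k with rfl | hk
  · simp [goldbachLambdaCount]
  · have h := hA k hk
    push_cast at h
    have hx := pow_nonneg hx0 k
    calc δ * q * ((k : ℝ) * goldbachSingularSeries (q * k) * (ρ ^ q) ^ k)
        = δ * (goldbachSingularSeries (q * k) * ((q : ℝ) * k)) * (ρ ^ q) ^ k := by ring
      _ ≤ goldbachLambdaCount (q * k) * (ρ ^ q) ^ k := mul_le_mul_of_nonneg_right h hx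

end GoldstonSuriajaya

end Literature.Barriers.Parity
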